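import Mathlib.Algebra.Algebra.Subalgebra.Centralizer
import Summits.HubbardSuperconductivity.HubbardSuperconductivity.Theorems.BalabanIRBirEveryGroundStateClosures

/-!
# Route `LogColdTorus`, crux `AverageToEvery` (item `stmt-HubbardSuperconductivity-10519`),
# line `birth`: the over-strength of the line's BET (lead c21, dead-line record `Lines/birth-dead.md` §2(d))

Helper (`--supports`) for the crux
`Summit.HubbardSuperconductivity.HubbardSuperconductivity.Theses.LogColdTorus.AverageToEvery`.

The one open stub of line `birth` (`stub_liveDopedCountableAccidentalCouplings`) concludes, per
coupling `U`, side `L` and particle number `N`, that the sector ground eigenspace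
`E₀ = szSector N 0 ⊓ ker (H - e₀)` of `H = hubbardTorus 2 L 1 U` is IRREDUCIBLE under the joint
commutant of `H`, `N̂`, `S^z` and `Y = Δ_d† Δ_d`. The landed `stub_schurScalarOnGround` draws from
this the one consequence the composition uses (`Y` has scalar matrix elements on `E₀`). This file
records in the kernel how much MORE the stub asserts: under the same irreducibility hypothesis

* `scalarMatrixElements_of_irreducibleGround_of_commute` — EVERY matrix `b` commuting with the
  joint commutant has scalar matrix elements on `E₀` (`⟨w, b v⟩ = μ_b ⟨w, v⟩`, `v, w ∈ E₀`);
* `scalarMatrixElements_of_irreducibleGround_of_mem_adjoin` — in particular every element of the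
  subalgebra `Algebra.adjoin ℂ {H, N̂, S^z, Y}` (every non-commutative polynomial in the four);
* `scalarMatrixElements_pairSq_of_irreducibleGround`,
  `scalarMatrixElements_pairHpair_of_irreducibleGround` — e.g. `Y * Y` and `Y * H * Y`: under the
  stub, `‖Δ_d†Δ_d ψ‖²` and `⟨Δ_d†Δ_d ψ, H Δ_d†Δ_d ψ⟩` are the same for all unit `ψ ∈ E₀`,

whereas the crux needs a single inequality on the single compression `P_{E₀} Y P_{E₀}`
(`Theorems.averageToEvery_iff_liveDopedTransfer`). (Equivalently — not formalised here — the stub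
says `P_{E₀}` is a minimal projection of the *-algebra generated by `H, N̂, S^z, Y`: finite-dimensional
bicommutant.) Schur: Serre, *Linear Representations of Finite Groups* §2.2; Tasaki (2020) §9.3;
centralisers: Bourbaki, *Algèbre* VIII §1. Folklore; no definition and no named fact is introduced.
-/

noncomputable section

-- `dupNamespace`: the summit and the problem are both named `HubbardSuperconductivity` (layout D-0022)
set_option linter.dupNamespace false

namespace Summit.HubbardSuperconductivity.HubbardSuperconductivity.Theorems

open Matrix Finset
open Literature.Probability.LatticeModels Literature.MathematicalPhysics.QuantumLattice
open scoped ComplexOrder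

/-- **Schur on the joint commutant, general observable.** At any coupling `U`, side `L` and
particle number `N`: if the sector ground eigenspace `E₀ = szSector N 0 ⊓ ker (H - e₀)` of
`H = hubbardTorus 2 L 1 U` is irreducible under the matrices commuting with `H`, `N̂`, `S^z` and
`Y = Δ_d† Δ_d` (the conclusion of the BET of line `birth` at `(U, L, N)`), then EVERY matrix `b`
that commutes with all such matrices has scalar matrix elements on `E₀`:
`⟨w, b v⟩ = μ ⟨w, v⟩` for `v, w ∈ E₀`. (The commutant preserves `E₀`, is `ᴴ`-closed, and commutes
with `b`; Schur for the compression `P b P`, `exists_scalar_matrixElements_of_irreducible`.)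
Serre, *Linear Representations of Finite Groups* §2.2. [folklore] -/
theorem scalarMatrixElements_of_irreducibleGround_of_commute (U : ℝ) (L N : ℕ) [NeZero L]
    (hirr : ∀ K' : Submodule ℂ (Fock (Orb (FermionTorus 2 L))),
      K' ≤ szSector N 0 ⊓
        Module.End.eigenspace (Matrix.toLin' (hubbardTorus 2 L 1 U))
          ((((hubbardTorus 2 L 1 U).minEnergyOn (szSector N 0) : ℝ) : ℂ)) →
      (∀ X : Matrix (Finset (Orb (FermionTorus 2 L))) (Finset (Orb (FermionTorus 2 L))) ℂ,
        X * hubbardTorus 2 L 1 U = hubbardTorus 2 L 1 U * X →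
        X * totalNumber = totalNumber * X →
        X * HubbardWave0.spinZ = HubbardWave0.spinZ * X →
        X * ((pairField dWaveFormFactor L)ᴴ * pairField dWaveFormFactor L) =
          (pairField dWaveFormFactor L)ᴴ * pairField dWaveFormFactor L * X →
        ∀ v ∈ K', X *ᵥ v ∈ K') →
      K' = ⊥ ∨
        K' = szSector N 0 ⊓
          Module.End.eigenspace (Matrix.toLin' (hubbardTorus 2 L 1 U))
            ((((hubbardTorus 2 L 1 U).minEnergyOn (szSector N 0) : ℝ) : ℂ)))
    (b : Matrix (Finset (Orb (FermionTorus 2 L))) (Finset (Orb (FermionTorus 2 L))) ℂ)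
    (hb : ∀ X : Matrix (Finset (Orb (FermionTorus 2 L))) (Finset (Orb (FermionTorus 2 L))) ℂ,
      X * hubbardTorus 2 L 1 U = hubbardTorus 2 L 1 U * X →
      X * totalNumber = totalNumber * X →
      X * HubbardWave0.spinZ = HubbardWave0.spinZ * X →
      X * ((pairField dWaveFormFactor L)ᴴ * pairField dWaveFormFactor L) =
        (pairField dWaveFormFactor L)ᴴ * pairField dWaveFormFactor L * X →
      X * b = b * X) :
    ∃ μ : ℂ,
      ∀ v ∈ szSector N 0 ⊓
          Module.End.eigenspace (Matrix.toLin' (hubbardTorus 2 L 1 U))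
            ((((hubbardTorus 2 L 1 U).minEnergyOn (szSector N 0) : ℝ) : ℂ)),
        ∀ w ∈ szSector N 0 ⊓
            Module.End.eigenspace (Matrix.toLin' (hubbardTorus 2 L 1 U))
              ((((hubbardTorus 2 L 1 U).minEnergyOn (szSector N 0) : ℝ) : ℂ)),
          star w ⬝ᵥ b *ᵥ v = μ * (star w ⬝ᵥ v) := by
  -- name the objects of side `L`
  set Y : Matrix (Finset (Orb (FermionTorus 2 L))) (Finset (Orb (FermionTorus 2 L))) ℂ :=
    (pairField dWaveFormFactor L)ᴴ * pairField dWaveFormFactor L with hY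
  set H := hubbardTorus 2 L 1 U with hH
  set Sec := szSector (Λ := FermionTorus 2 L) N 0 with hSec
  set E₀ := Sec ⊓ Module.End.eigenspace (Matrix.toLin' H) ((H.minEnergyOn Sec : ℝ) : ℂ) with hE₀
  -- the joint commutant
  let Sym : Set (Matrix (Finset (Orb (FermionTorus 2 L))) (Finset (Orb (FermionTorus 2 L))) ℂ) :=
    {X | X * H = H * X ∧ X * totalNumber = totalNumber * X ∧
      X * HubbardWave0.spinZ = HubbardWave0.spinZ * X ∧ X * Y = Y * X}
  have hSb : ∀ X ∈ Sym, X * b = b * X := fun X hX => hb X hX.1 hX.2.1 hX.2.2.1 hX.2.2.2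
  have hSK : ∀ X ∈ Sym, ∀ v ∈ E₀, X *ᵥ v ∈ E₀ := fun X hX v hv =>
    mulVec_mem_groundEigenspace_of_commute L H X _ 0 hX.1 hX.2.1 hX.2.2.1 hv
  have hSK' : ∀ X ∈ Sym, ∀ v ∈ E₀, Xᴴ *ᵥ v ∈ E₀ := by
    intro X hX v hv
    obtain ⟨h1, h2, h3, -⟩ := conjTranspose_mem_symmetries L 1 U dWaveFormFactor
      hX.1 hX.2.1 hX.2.2.1 hX.2.2.2
    exact mulVec_mem_groundEigenspace_of_commute L H Xᴴ _ 0 h1 h2 h3 hv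
  have hirr' : ∀ K' : Submodule ℂ (Fock (Orb (FermionTorus 2 L))), K' ≤ E₀ →
      (∀ X ∈ Sym, ∀ v ∈ K', X *ᵥ v ∈ K') → K' = ⊥ ∨ K' = E₀ := fun K' hK' hinv =>
    hirr K' hK' fun X h1 h2 h3 h4 v hv => hinv X ⟨h1, h2, h3, h4⟩ v hv
  exact exists_scalar_matrixElements_of_irreducible E₀ b Sym hSb hSK hSK' hirr'

/-- **Every non-commutative polynomial in `H, N̂, S^z, Δ_d†Δ_d` is scalar on an irreducible
floor.** Under the irreducibility hypothesis of the BET of line `birth` at `(U, L, N)`, every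
element `b` of the subalgebra `Algebra.adjoin ℂ {H, N̂, S^z, Y}` (`H = hubbardTorus 2 L 1 U`,
`Y = Δ_d† Δ_d`) has scalar matrix elements on the sector ground eigenspace `E₀`: a matrix commuting
with the four generators commutes with the subalgebra they generate
(`Algebra.adjoin_le_centralizer_centralizer`), so the previous theorem applies. This is the
over-strength of the stub relative to the crux, which needs one inequality on the single
compression `P Y P`. Bourbaki, *Algèbre* VIII §1 (bicommutant); Serre §2.2. [folklore] -/
theorem scalarMatrixElements_of_irreducibleGround_of_mem_adjoin (U : ℝ) (L N : ℕ) [NeZero L]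
    (hirr : ∀ K' : Submodule ℂ (Fock (Orb (FermionTorus 2 L))),
      K' ≤ szSector N 0 ⊓
        Module.End.eigenspace (Matrix.toLin' (hubbardTorus 2 L 1 U))
          ((((hubbardTorus 2 L 1 U).minEnergyOn (szSector N 0) : ℝ) : ℂ)) →
      (∀ X : Matrix (Finset (Orb (FermionTorus 2 L))) (Finset (Orb (FermionTorus 2 L))) ℂ,
        X * hubbardTorus 2 L 1 U = hubbardTorus 2 L 1 U * X →
        X * totalNumber = totalNumber * X →
        X * HubbardWave0.spinZ = HubbardWave0.spinZ * X →
        X * ((pairField dWaveFormFactor L)ᴴ * pairField dWaveFormFactor L) =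
          (pairField dWaveFormFactor L)ᴴ * pairField dWaveFormFactor L * X →
        ∀ v ∈ K', X *ᵥ v ∈ K') →
      K' = ⊥ ∨
        K' = szSector N 0 ⊓
          Module.End.eigenspace (Matrix.toLin' (hubbardTorus 2 L 1 U))
            ((((hubbardTorus 2 L 1 U).minEnergyOn (szSector N 0) : ℝ) : ℂ)))
    (b : Matrix (Finset (Orb (FermionTorus 2 L))) (Finset (Orb (FermionTorus 2 L))) ℂ)
    (hb : b ∈ Algebra.adjoin ℂ
      ({hubbardTorus 2 L 1 U, totalNumber, HubbardWave0.spinZ,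
        (pairField dWaveFormFactor L)ᴴ * pairField dWaveFormFactor L} :
        Set (Matrix (Finset (Orb (FermionTorus 2 L))) (Finset (Orb (FermionTorus 2 L))) ℂ))) :
    ∃ μ : ℂ,
      ∀ v ∈ szSector N 0 ⊓
          Module.End.eigenspace (Matrix.toLin' (hubbardTorus 2 L 1 U))
            ((((hubbardTorus 2 L 1 U).minEnergyOn (szSector N 0) : ℝ) : ℂ)),
        ∀ w ∈ szSector N 0 ⊓
            Module.End.eigenspace (Matrix.toLin' (hubbardTorus 2 L 1 U))
              ((((hubbardTorus 2 L 1 U).minEnergyOn (szSector N 0) : ℝ) : ℂ)),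
          star w ⬝ᵥ b *ᵥ v = μ * (star w ⬝ᵥ v) := by
  refine scalarMatrixElements_of_irreducibleGround_of_commute U L N hirr b ?_
  intro X h1 h2 h3 h4
  -- `X` lies in the centraliser of the four generators, hence commutes with the subalgebra
  set gens : Set (Matrix (Finset (Orb (FermionTorus 2 L))) (Finset (Orb (FermionTorus 2 L))) ℂ) :=
    {hubbardTorus 2 L 1 U, totalNumber, HubbardWave0.spinZ,
      (pairField dWaveFormFactor L)ᴴ * pairField dWaveFormFactor L} with hgens
  have hX : X ∈ gens.centralizer := by
    rw [Set.mem_centralizer_iff]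
    intro m hm
    simp only [hgens, Set.mem_insert_iff, Set.mem_singleton_iff] at hm
    rcases hm with rfl | rfl | rfl | rfl
    · exact h1.symm
    · exact h2.symm
    · exact h3.symm
    · exact h4.symm
  have hb' : b ∈ Subalgebra.centralizer ℂ gens.centralizer :=
    Algebra.adjoin_le_centralizer_centralizer ℂ gens hb
  rw [Subalgebra.mem_centralizer_iff] at hb'
  exact hb' X hX

/-- **Corollary: `(Δ_d†Δ_d)²` is scalar on an irreducible floor**, i.e. under the BET of line
`birth` at `(U, L, N)` the norm `‖Δ_d†Δ_d ψ‖` is the same for every unit sector ground state `ψ`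
(matrix-element form). [folklore] -/
theorem scalarMatrixElements_pairSq_of_irreducibleGround (U : ℝ) (L N : ℕ) [NeZero L]
    (hirr : ∀ K' : Submodule ℂ (Fock (Orb (FermionTorus 2 L))),
      K' ≤ szSector N 0 ⊓
        Module.End.eigenspace (Matrix.toLin' (hubbardTorus 2 L 1 U))
          ((((hubbardTorus 2 L 1 U).minEnergyOn (szSector N 0) : ℝ) : ℂ)) →
      (∀ X : Matrix (Finset (Orb (FermionTorus 2 L))) (Finset (Orb (FermionTorus 2 L))) ℂ,
        X * hubbardTorus 2 L 1 U = hubbardTorus 2 L 1 U * X →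
        X * totalNumber = totalNumber * X →
        X * HubbardWave0.spinZ = HubbardWave0.spinZ * X →
        X * ((pairField dWaveFormFactor L)ᴴ * pairField dWaveFormFactor L) =
          (pairField dWaveFormFactor L)ᴴ * pairField dWaveFormFactor L * X →
        ∀ v ∈ K', X *ᵥ v ∈ K') →
      K' = ⊥ ∨
        K' = szSector N 0 ⊓
          Module.End.eigenspace (Matrix.toLin' (hubbardTorus 2 L 1 U))
            ((((hubbardTorus 2 L 1 U).minEnergyOn (szSector N 0) : ℝ) : ℂ))) :
    ∃ μ : ℂ,
      ∀ v ∈ szSector N 0 ⊓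
          Module.End.eigenspace (Matrix.toLin' (hubbardTorus 2 L 1 U))
            ((((hubbardTorus 2 L 1 U).minEnergyOn (szSector N 0) : ℝ) : ℂ)),
        ∀ w ∈ szSector N 0 ⊓
            Module.End.eigenspace (Matrix.toLin' (hubbardTorus 2 L 1 U))
              ((((hubbardTorus 2 L 1 U).minEnergyOn (szSector N 0) : ℝ) : ℂ)),
          star w ⬝ᵥ
              ((pairField dWaveFormFactor L)ᴴ * pairField dWaveFormFactor L *
                ((pairField dWaveFormFactor L)ᴴ * pairField dWaveFormFactor L)) *ᵥ v =
            μ * (star w ⬝ᵥ v) := by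
  refine scalarMatrixElements_of_irreducibleGround_of_commute U L N hirr _ ?_
  intro X _ _ _ h4
  generalize hY : (pairField dWaveFormFactor L)ᴴ * pairField dWaveFormFactor L = Y at h4 ⊢
  calc X * (Y * Y) = (X * Y) * Y := by simp only [Matrix.mul_assoc]
    _ = (Y * X) * Y := by rw [h4]
    _ = Y * (X * Y) := by simp only [Matrix.mul_assoc]
    _ = Y * (Y * X) := by rw [h4]
    _ = Y * Y * X := by simp only [Matrix.mul_assoc]

/-- **Corollary: `Δ_d†Δ_d · H · Δ_d†Δ_d` is scalar on an irreducible floor**, i.e. under the BET of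
line `birth` at `(U, L, N)` the energy form `⟨Δ_d†Δ_d ψ, H Δ_d†Δ_d ψ⟩` is the same for every unit
sector ground state `ψ` (matrix-element form) — one of the infinitely many constraints the stub adds
to the single compression bound the crux needs. [folklore] -/
theorem scalarMatrixElements_pairHpair_of_irreducibleGround (U : ℝ) (L N : ℕ) [NeZero L]
    (hirr : ∀ K' : Submodule ℂ (Fock (Orb (FermionTorus 2 L))),
      K' ≤ szSector N 0 ⊓
        Module.End.eigenspace (Matrix.toLin' (hubbardTorus 2 L 1 U))
          ((((hubbardTorus 2 L 1 U).minEnergyOn (szSector N 0) : ℝ) : ℂ)) →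
      (∀ X : Matrix (Finset (Orb (FermionTorus 2 L))) (Finset (Orb (FermionTorus 2 L))) ℂ,
        X * hubbardTorus 2 L 1 U = hubbardTorus 2 L 1 U * X →
        X * totalNumber = totalNumber * X →
        X * HubbardWave0.spinZ = HubbardWave0.spinZ * X →
        X * ((pairField dWaveFormFactor L)ᴴ * pairField dWaveFormFactor L) =
          (pairField dWaveFormFactor L)ᴴ * pairField dWaveFormFactor L * X →
        ∀ v ∈ K', X *ᵥ v ∈ K') →
      K' = ⊥ ∨
        K' = szSector N 0 ⊓
          Module.End.eigenspace (Matrix.toLin' (hubbardTorus 2 L 1 U))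
            ((((hubbardTorus 2 L 1 U).minEnergyOn (szSector N 0) : ℝ) : ℂ))) :
    ∃ μ : ℂ,
      ∀ v ∈ szSector N 0 ⊓
          Module.End.eigenspace (Matrix.toLin' (hubbardTorus 2 L 1 U))
            ((((hubbardTorus 2 L 1 U).minEnergyOn (szSector N 0) : ℝ) : ℂ)),
        ∀ w ∈ szSector N 0 ⊓
            Module.End.eigenspace (Matrix.toLin' (hubbardTorus 2 L 1 U))
              ((((hubbardTorus 2 L 1 U).minEnergyOn (szSector N 0) : ℝ) : ℂ)),
          star w ⬝ᵥ
              ((pairField dWaveFormFactor L)ᴴ * pairField dWaveFormFactor L *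
                hubbardTorus 2 L 1 U *
                ((pairField dWaveFormFactor L)ᴴ * pairField dWaveFormFactor L)) *ᵥ v =
            μ * (star w ⬝ᵥ v) := by
  refine scalarMatrixElements_of_irreducibleGround_of_commute U L N hirr _ ?_
  intro X h1 _ _ h4
  generalize hY : (pairField dWaveFormFactor L)ᴴ * pairField dWaveFormFactor L = Y at h4 ⊢
  generalize hH : hubbardTorus 2 L 1 U = H at h1 ⊢
  calc X * (Y * H * Y) = (X * Y) * H * Y := by simp only [Matrix.mul_assoc]
    _ = (Y * X) * H * Y := by rw [h4]
    _ = Y * (X * H) * Y := by simp only [Matrix.mul_assoc]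
    _ = Y * (H * X) * Y := by rw [h1]
    _ = Y * H * (X * Y) := by simp only [Matrix.mul_assoc]
    _ = Y * H * (Y * X) := by rw [h4]
    _ = Y * H * Y * X := by simp only [Matrix.mul_assoc]


/-- **Registered sub-goal `overStrength_adjoinScalarOnGround`** (the `∀`-packaged form of
`scalarMatrixElements_of_irreducibleGround_of_mem_adjoin`, stated `:=`-free for the stub registrar):
at any `(U, L, N)`, irreducibility of the sector ground eigenspace under the joint commutant of
`H, N̂, S^z, Δ_d†Δ_d` forces EVERY element of `Algebra.adjoin ℂ {H, N̂, S^z, Δ_d†Δ_d}` to have scalar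
matrix elements on it. Serre §2.2; Bourbaki, *Algèbre* VIII §1. [folklore] -/
theorem overStrength_adjoinScalarOnGround :
    ∀ (U : ℝ) (L N : ℕ) [NeZero L], (∀ K' : Submodule ℂ (Fock (Orb (FermionTorus 2 L))), K' ≤ szSector N 0 ⊓ Module.End.eigenspace (Matrix.toLin' (hubbardTorus 2 L 1 U)) ((((hubbardTorus 2 L 1 U).minEnergyOn (szSector N 0) : ℝ) : ℂ)) → (∀ X : Matrix (Finset (Orb (FermionTorus 2 L))) (Finset (Orb (FermionTorus 2 L))) ℂ, X * hubbardTorus 2 L 1 U = hubbardTorus 2 L 1 U * X → X * totalNumber = totalNumber * X → X * HubbardWave0.spinZ = HubbardWave0.spinZ * X → X * ((pairField dWaveFormFactor L)ᴴ * pairField dWaveFormFactor L) = (pairField dWaveFormFactor L)ᴴ * pairField dWaveFormFactor L * X → ∀ v ∈ K', X *ᵥ v ∈ K') → K' = ⊥ ∨ K' = szSector N 0 ⊓ Module.End.eigenspace (Matrix.toLin' (hubbardTorus 2 L 1 U)) ((((hubbardTorus 2 L 1 U).minEnergyOn (szSector N 0) : ℝ) : ℂ))) → ∀ b ∈ Algebra.adjoin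 ℂ ({hubbardTorus 2 L 1 U, totalNumber, HubbardWave0.spinZ, (pairField dWaveFormFactor L)ᴴ * pairField dWaveFormFactor L} : Set (Matrix (Finset (Orb (FermionTorus 2 L))) (Finset (Orb (FermionTorus 2 L))) ℂ)), ∃ μ : ℂ, ∀ v ∈ szSector N 0 ⊓ Module.End.eigenspace (Matrix.toLin' (hubbardTorus 2 L 1 U)) ((((hubbardTorus 2 L 1 U).minEnergyOn (szSector N 0) : ℝ) : ℂ)), ∀ w ∈ szSector N 0 ⊓ Module.End.eigenspace (Matrix.toLin' (hubbardTorus 2 L 1 U)) ((((hubbardTorus 2 L 1 U).minEnergyOn (szSector N 0) : ℝ) : ℂ)), star w ⬝ᵥ b *ᵥ v = μ * (star w ⬝ᵥ v) := by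
  intro U L N _ hirr b hb
  exact scalarMatrixElements_of_irreducibleGround_of_mem_adjoin U L N hirr b hb

end Summit.HubbardSuperconductivity.HubbardSuperconductivity.Theorems

end
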